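import Summits.RiemannHypothesis.RiemannHypothesis.Theorems.TiltedLandingLaw421R3SinkBdry

/-!
# «SinkScale» v1 — degree-(−1) HOMOGENEITY of 110's closed forms and DILATION INVARIANCE of corner level and boundary domination
(C1 desk, rh-idea-5 g39; files-only; SUPPORT, K only; invited (CA999)(1), RSV 118 (CA1002)(2) — v1 = homogeneity half, author's choice)

ONE import: TREE #1261 «SinkBdry» (110).  Namespace `RhW08.SinkScale`; nothing re-declared.  (K) only, asserts no law.
Under the dilation `(δ, t, h, ξ, b) ↦ (c·δ, c·t, c·h, c·ξ, c·b)`, `c ≠ 0`, the pair imaginary-part form `pairCForm` and the two-point numerator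
`twoPointNForm` pick up the factor `c⁻¹` (`pairCForm_scale`, `twoPointNForm_scale`; the shape lemmas hold at the junk value `1/0 = 0` too), so the
corner level `cornerSigmaForm` is INVARIANT under `(R, δ, t, h) ↦ (c·R, c·δ, c·t, c·h)` (`cornerSigmaForm_scale`), and for `0 < c` so is boundary
domination: `bdryDomForm_scale : BdryDomForm (cR) (cδ) (ct) (ch) y0 σ ↔ BdryDomForm R δ t h y0 σ` (column / lid quantifiers reparametrised by
`forall_col_scale`, `forall_lid_scale(_neg)`).  Use: a corner-dominance certificate computed at ONE extent (e.g. `R = 2`) is valid at every `R > 0`.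
Not here: the strict-cone positivity of `pairCForm` (separate small drawer).
LEVEL: SUPPORT (K).  No `sorry`.  Nothing here bears on the truth of RH; RH is not proved; ⟨33346⟩/⟨33347⟩ OPEN; checked ≠ keyed ≠ landed ≠ proved.
-/

noncomputable section

open RhW08.SinkBdry

namespace RhW08.SinkScale

/-- Scaling of an inverse squared distance, first shape: `1/((c x)² + (c y − c z)²) = c⁻² · 1/(x² + (y − z)²)` (also at the junk value). -/
theorem inv_scale_sub (c x y z : ℝ) (hc : c ≠ 0) :
    1 / ((c * x) ^ 2 + (c * y - c * z) ^ 2) = c⁻¹ * c⁻¹ * (1 / (x ^ 2 + (y - z) ^ 2)) := by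
  have h : (c * x) ^ 2 + (c * y - c * z) ^ 2 = c ^ 2 * (x ^ 2 + (y - z) ^ 2) := by ring
  rw [h]
  by_cases hD : x ^ 2 + (y - z) ^ 2 = 0
  · simp [hD]
  · field_simp

/-- Scaling of an inverse squared distance, second shape: `1/((c x)² + (c y + c z)²) = c⁻² · 1/(x² + (y + z)²)`. -/
theorem inv_scale_add (c x y z : ℝ) (hc : c ≠ 0) :
    1 / ((c * x) ^ 2 + (c * y + c * z) ^ 2) = c⁻¹ * c⁻¹ * (1 / (x ^ 2 + (y + z) ^ 2)) := by
  have h : (c * x) ^ 2 + (c * y + c * z) ^ 2 = c ^ 2 * (x ^ 2 + (y + z) ^ 2) := by ring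
  rw [h]
  by_cases hD : x ^ 2 + (y + z) ^ 2 = 0
  · simp [hD]
  · field_simp

/-- Third shape: `1/((c x − c w)² + (c y − c z)²) = c⁻² · 1/((x − w)² + (y − z)²)`. -/
theorem inv_scale_sub_sub (c x w y z : ℝ) (hc : c ≠ 0) :
    1 / ((c * x - c * w) ^ 2 + (c * y - c * z) ^ 2) = c⁻¹ * c⁻¹ * (1 / ((x - w) ^ 2 + (y - z) ^ 2)) := by
  have h : (c * x - c * w) ^ 2 + (c * y - c * z) ^ 2 = c ^ 2 * ((x - w) ^ 2 + (y - z) ^ 2) := by ring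
  rw [h]
  by_cases hD : (x - w) ^ 2 + (y - z) ^ 2 = 0
  · simp [hD]
  · field_simp

/-- Fourth shape: `1/((c x − c w)² + (c y + c z)²) = c⁻² · 1/((x − w)² + (y + z)²)`. -/
theorem inv_scale_sub_add (c x w y z : ℝ) (hc : c ≠ 0) :
    1 / ((c * x - c * w) ^ 2 + (c * y + c * z) ^ 2) = c⁻¹ * c⁻¹ * (1 / ((x - w) ^ 2 + (y + z) ^ 2)) := by
  have h : (c * x - c * w) ^ 2 + (c * y + c * z) ^ 2 = c ^ 2 * ((x - w) ^ 2 + (y + z) ^ 2) := by ring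
  rw [h]
  by_cases hD : (x - w) ^ 2 + (y + z) ^ 2 = 0
  · simp [hD]
  · field_simp

/-- Fraction shapes of `pairCForm`: `(c y − c z)/((c x − c w)² + (c y − c z)²) = c⁻¹ · (y − z)/((x − w)² + (y − z)²)`. -/
theorem frac_scale_sub (c x w y z : ℝ) (hc : c ≠ 0) :
    (c * y - c * z) / ((c * x - c * w) ^ 2 + (c * y - c * z) ^ 2) = c⁻¹ * ((y - z) / ((x - w) ^ 2 + (y - z) ^ 2)) := by
  rw [div_eq_mul_one_div, inv_scale_sub_sub c x w y z hc, div_eq_mul_one_div (y - z)]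
  field_simp

/-- `(c y + c z)/((c x − c w)² + (c y + c z)²) = c⁻¹ · (y + z)/((x − w)² + (y + z)²)`. -/
theorem frac_scale_add (c x w y z : ℝ) (hc : c ≠ 0) :
    (c * y + c * z) / ((c * x - c * w) ^ 2 + (c * y + c * z) ^ 2) = c⁻¹ * ((y + z) / ((x - w) ^ 2 + (y + z) ^ 2)) := by
  rw [div_eq_mul_one_div, inv_scale_sub_add c x w y z hc, div_eq_mul_one_div (y + z)]
  field_simp

/-- ★ `pairCForm` is homogeneous of degree −1: `pairCForm (cδ) (ct) (cξ) (cb) = c⁻¹ · pairCForm δ t ξ b` for `c ≠ 0`. -/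
theorem pairCForm_scale (c δ t ξ b : ℝ) (hc : c ≠ 0) :
    pairCForm (c * δ) (c * t) (c * ξ) (c * b) = c⁻¹ * pairCForm δ t ξ b := by
  unfold pairCForm
  rw [frac_scale_sub c δ ξ t b hc, frac_scale_add c δ ξ t b hc]
  ring

/-- ★ `twoPointNForm` is homogeneous of degree −1: `twoPointNForm (cδ) (ct) (ch) y0 (cξ) (cb) = c⁻¹ · twoPointNForm δ t h y0 ξ b` for `c ≠ 0`. -/
theorem twoPointNForm_scale (c δ t h y0 ξ b : ℝ) (hc : c ≠ 0) :
    twoPointNForm (c * δ) (c * t) (c * h) y0 (c * ξ) (c * b) = c⁻¹ * twoPointNForm δ t h y0 ξ b := by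
  unfold twoPointNForm
  rw [inv_scale_sub c ξ t b hc, inv_scale_add c ξ t b hc, inv_scale_sub c ξ h b hc, inv_scale_add c ξ h b hc,
    inv_scale_sub_sub c δ ξ t b hc, inv_scale_sub_add c δ ξ t b hc]
  have hcc : c * c⁻¹ = 1 := mul_inv_cancel₀ hc
  linear_combination
    (-(y0 * ξ * (c⁻¹ * (1 / (ξ ^ 2 + (t - b) ^ 2)) + c⁻¹ * (1 / (ξ ^ 2 + (t + b) ^ 2))))
      - (1 - y0) * ξ * (c⁻¹ * (1 / (ξ ^ 2 + (h - b) ^ 2)) + c⁻¹ * (1 / (ξ ^ 2 + (h + b) ^ 2)))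
      - (δ - ξ) * (c⁻¹ * (1 / ((δ - ξ) ^ 2 + (t - b) ^ 2)) + c⁻¹ * (1 / ((δ - ξ) ^ 2 + (t + b) ^ 2)))) * hcc

/-- ★ The corner level is dilation-INVARIANT: `cornerSigmaForm (cR) (cδ) (ct) (ch) y0 = cornerSigmaForm R δ t h y0` for `c ≠ 0`. -/
theorem cornerSigmaForm_scale (c R δ t h y0 : ℝ) (hc : c ≠ 0) :
    cornerSigmaForm (c * R) (c * δ) (c * t) (c * h) y0 = cornerSigmaForm R δ t h y0 := by
  unfold cornerSigmaForm
  have h1 : c * R / 2 = c * (R / 2) := by ring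
  have h2 : -(c * (R / 2)) = c * (-(R / 2)) := by ring
  rw [h1, h2, twoPointNForm_scale c δ t h y0 (R / 2) (R / 2) hc, pairCForm_scale c δ t (R / 2) (R / 2) hc,
    twoPointNForm_scale c δ t h y0 (-(R / 2)) (R / 2) hc, pairCForm_scale c δ t (-(R / 2)) (R / 2) hc,
    mul_div_mul_left _ _ (inv_ne_zero hc), mul_div_mul_left _ _ (inv_ne_zero hc)]

/-- Order bookkeeping: a common positive factor `k` cancels from `k·N ≤ σ·(k·C)`. -/
theorem le_scale_iff (k N σ C : ℝ) (hk : 0 < k) : k * N ≤ σ * (k * C) ↔ N ≤ σ * C := by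
  constructor
  · intro h
    have h' := mul_le_mul_of_nonneg_left h (inv_pos.2 hk).le
    rw [inv_mul_cancel_left₀ hk.ne', mul_left_comm, inv_mul_cancel_left₀ hk.ne'] at h'
    exact h'
  · intro h
    have h' := mul_le_mul_of_nonneg_left h hk.le
    rwa [mul_left_comm] at h'

/-- Pointwise form of the scaling: the boundary inequality at the dilated point is the boundary inequality at the original point (`0 < c`). -/
theorem bdryIneq_scale (c δ t h y0 σ ξ b : ℝ) (hc : 0 < c) :
    twoPointNForm (c * δ) (c * t) (c * h) y0 (c * ξ) (c * b) ≤ σ * pairCForm (c * δ) (c * t) (c * ξ) (c * b) ↔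
      twoPointNForm δ t h y0 ξ b ≤ σ * pairCForm δ t ξ b := by
  rw [twoPointNForm_scale c δ t h y0 ξ b hc.ne', pairCForm_scale c δ t ξ b hc.ne']
  exact le_scale_iff c⁻¹ _ σ _ (inv_pos.2 hc)

/-- Reparametrisation of a column quantifier `b ∈ [0, c·a]` by `b = c·b'`, `b' ∈ [0, a]` (`0 < c`). -/
theorem forall_col_scale (c a : ℝ) (hc : 0 < c) (P : ℝ → Prop) :
    (∀ b : ℝ, 0 ≤ b → b ≤ c * a → P b) ↔ (∀ b : ℝ, 0 ≤ b → b ≤ a → P (c * b)) := by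
  constructor
  · intro H b hb hba
    exact H (c * b) (mul_nonneg hc.le hb) (mul_le_mul_of_nonneg_left hba hc.le)
  · intro H b hb hba
    have e : c * (b / c) = b := by field_simp
    have hb' : b / c ≤ a := by rw [div_le_iff₀ hc]; linarith
    simpa only [e] using H (b / c) (div_nonneg hb hc.le) hb'

/-- Reparametrisation of a right-lid quantifier `c·a ≤ ξ` by `ξ = c·ξ'`, `a ≤ ξ'` (`0 < c`). -/
theorem forall_lid_scale (c a : ℝ) (hc : 0 < c) (P : ℝ → Prop) :
    (∀ ξ : ℝ, c * a ≤ ξ → P ξ) ↔ (∀ ξ : ℝ, a ≤ ξ → P (c * ξ)) := by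
  constructor
  · intro H ξ hξ
    exact H (c * ξ) (mul_le_mul_of_nonneg_left hξ hc.le)
  · intro H ξ hξ
    have e : c * (ξ / c) = ξ := by field_simp
    have hξ' : a ≤ ξ / c := by rw [le_div_iff₀ hc]; linarith
    simpa only [e] using H (ξ / c) hξ'

/-- Reparametrisation of a left-lid quantifier `c·a ≤ −ξ` by `ξ = c·ξ'`, `a ≤ −ξ'` (`0 < c`). -/
theorem forall_lid_scale_neg (c a : ℝ) (hc : 0 < c) (P : ℝ → Prop) :
    (∀ ξ : ℝ, c * a ≤ -ξ → P ξ) ↔ (∀ ξ : ℝ, a ≤ -ξ → P (c * ξ)) := by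
  constructor
  · intro H ξ hξ
    have h1 : c * a ≤ c * (-ξ) := mul_le_mul_of_nonneg_left hξ hc.le
    exact H (c * ξ) (by linarith [h1, mul_neg c ξ])
  · intro H ξ hξ
    have e : c * (ξ / c) = ξ := by field_simp
    have hξ' : a ≤ -(ξ / c) := by rw [← neg_div, le_div_iff₀ hc]; linarith
    simpa only [e] using H (ξ / c) hξ'

/-- ★ Boundary domination is dilation-INVARIANT: `BdryDomForm (cR) (cδ) (ct) (ch) y0 σ ↔ BdryDomForm R δ t h y0 σ` for `0 < c`.  With
`cornerSigmaForm_scale` this moves a corner-dominance certificate computed at one extent (e.g. `R = 2`) to every extent. -/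
theorem bdryDomForm_scale (c R δ t h y0 σ : ℝ) (hc : 0 < c) :
    BdryDomForm (c * R) (c * δ) (c * t) (c * h) y0 σ ↔ BdryDomForm R δ t h y0 σ := by
  unfold BdryDomForm
  have h1 : c * R / 2 = c * (R / 2) := by ring
  have h2 : -(c * (R / 2)) = c * (-(R / 2)) := by ring
  rw [h1, h2]
  refine and_congr ?_ (and_congr ?_ (and_congr ?_ ?_))
  · exact (forall_col_scale c (R / 2) hc _).trans
      (forall_congr' fun b => imp_congr_right fun _ => imp_congr_right fun _ => bdryIneq_scale c δ t h y0 σ (R / 2) b hc)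
  · exact (forall_col_scale c (R / 2) hc _).trans
      (forall_congr' fun b => imp_congr_right fun _ => imp_congr_right fun _ => bdryIneq_scale c δ t h y0 σ (-(R / 2)) b hc)
  · exact (forall_lid_scale c (R / 2) hc _).trans
      (forall_congr' fun ξ => imp_congr_right fun _ => bdryIneq_scale c δ t h y0 σ ξ (R / 2) hc)
  · exact (forall_lid_scale_neg c (R / 2) hc _).trans
      (forall_congr' fun ξ => imp_congr_right fun _ => bdryIneq_scale c δ t h y0 σ ξ (R / 2) hc)

end RhW08.SinkScale

end
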